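import Literature.AnabelianGeometry.AbsoluteAnabelian.AbsTopI.ChainTransport
import Mathlib.GroupTheory.Commensurable
import HarnessLib

/-!
# Transport of Π-chains — the de-cuspidalization operation • (PROOFS)

Proof-only companion to `AbsTopI/ChainTransport.lean` ([AbsTopI] Thm 4.7 (ii) p. 57, Def 4.2 (iii)
(c) and (3_Π) pp. 49–50): the operation • refers to "a cuspidal decomposition group in `Δⱼ`" (a
commensurator of the image under the rigidifying homomorphism of a decomposition group of a cusp);
these are transported EXACTLY by STRICT term isomorphisms over `φ` given corresponding cuspidal data
(`CuspidalDataCompat`): `Δ ↦ Δ`, conjugates under homomorphisms, the `J`-subgroups under strict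
isomorphisms (`Jgrp_transfer`), commensurators under isomorphisms (`commensurator_map_equiv`),
`map_mem_cuspidalDecompGroups`, and finally `isElemOp_deCusp_transfer`.  No definitions.
[cite: MochizukiAbsTopI2012, Thm 4.7 (ii) p.57]
-/

noncomputable section

open CategoryTheory Topology
open scoped Pointwise

universe u

namespace Literature.AnabelianGeometry.AbsoluteAnabelian.AbsTopI

open Literature.AlgebraicGeometry.Frobenioids (IsSlimGroup)
open FundamentalExtension

variable {E F : FundamentalExtension.{u}} (φ : E ≅ F)

/-! ### `Δ` under an isomorphism of extensions; conjugates under homomorphisms -/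

/-- An isomorphism of extensions carries `Δ_E` onto `Δ_F`. [cite: MochizukiAbsTopI2012, Thm 4.7 p.56] -/
theorem geom_map_iso : E.geom.map φ.hom.arith.toMonoidHom = F.geom := by
  ext y
  constructor
  · rintro ⟨x, hx, rfl⟩
    have hx' : E.aug x = 1 := hx
    change F.aug (φ.hom.arith x) = 1
    rw [φ.hom.comm, hx', map_one]
  · intro hy
    have hy' : F.aug y = 1 := hy
    refine ⟨φ.inv.arith y, ?_, iso_hom_inv_arith φ y⟩
    change E.aug (φ.inv.arith y) = 1
    rw [φ.inv.comm, hy', map_one]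

variable {φ}

/-- Conjugation commutes with homomorphisms: `f(gHg⁻¹) = f(g) f(H) f(g)⁻¹`.
[cite: MochizukiAbsTopI2012, Def 4.2 (iii) p.49] -/
theorem map_conj_smul {G H : Type u} [Group G] [Group H] (f : G →* H) (g : G) (K : Subgroup G) :
    (MulAut.conj g • K).map f = MulAut.conj (f g) • K.map f := by
  ext y
  simp only [Subgroup.mem_map, Subgroup.mem_smul_pointwise_iff_exists, MulAut.smul_def,
    MulAut.conj_apply]
  constructor
  · rintro ⟨_, ⟨k, hk, rfl⟩, rfl⟩
    exact ⟨f k, ⟨k, hk, rfl⟩, by rw [map_mul, map_mul, map_inv]⟩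
  · rintro ⟨_, ⟨k, hk, rfl⟩, rfl⟩
    exact ⟨g * k * g⁻¹, ⟨k, hk, rfl⟩, by rw [map_mul, map_mul, map_inv]⟩

/-- The same for the `ConjAct` action used by `Subgroup.Commensurable.commensurator`.
[cite: MochizukiAbsTopI2012, Def 4.2 (iii) p.49] -/
theorem map_conjAct_smul {G H : Type u} [Group G] [Group H] (f : G →* H) (g : G) (K : Subgroup G) :
    (ConjAct.toConjAct g • K).map f = ConjAct.toConjAct (f g) • K.map f := by
  ext y
  simp only [Subgroup.mem_map, Subgroup.mem_smul_pointwise_iff_exists, ConjAct.toConjAct_smul]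
  constructor
  · rintro ⟨_, ⟨k, hk, rfl⟩, rfl⟩
    exact ⟨f k, ⟨k, hk, rfl⟩, by rw [map_mul, map_mul, map_inv]⟩
  · rintro ⟨_, ⟨k, hk, rfl⟩, rfl⟩
    exact ⟨g * k * g⁻¹, ⟨k, hk, rfl⟩, by rw [map_mul, map_mul, map_inv]⟩

/-! ### Commensurators under isomorphisms -/

/-- Commensurability is invariant under injective homomorphisms.
[cite: MochizukiAbsTopI2012, Def 4.2 (iii) p.49] -/
theorem commensurable_map_iff {G H : Type u} [Group G] [Group H] {f : G →* H}
    (hf : Function.Injective f) (K K' : Subgroup G) :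
    Subgroup.Commensurable (K.map f) (K'.map f) ↔ Subgroup.Commensurable K K' := by
  unfold Subgroup.Commensurable
  rw [Subgroup.relIndex_map_map_of_injective _ _ hf, Subgroup.relIndex_map_map_of_injective _ _ hf]

/-- The commensurator is equivariant under group isomorphisms: `Comm(e(K)) = e(Comm(K))`.
[cite: MochizukiAbsTopI2012, Def 4.2 (iii) p.49] -/
theorem commensurator_map_equiv {G H : Type u} [Group G] [Group H] (e : G ≃* H) (K : Subgroup G) :
    Subgroup.Commensurable.commensurator (K.map (e : G →* H)) =
      (Subgroup.Commensurable.commensurator K).map (e : G →* H) := by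
  ext y
  rw [Subgroup.Commensurable.commensurator_mem_iff, Subgroup.mem_map]
  constructor
  · intro hy
    refine ⟨e.symm y, ?_, e.apply_symm_apply y⟩
    rw [Subgroup.Commensurable.commensurator_mem_iff,
      ← commensurable_map_iff (f := (e : G →* H)) (fun a b h => e.injective h), map_conjAct_smul]
    simpa using hy
  · rintro ⟨g, hg, rfl⟩
    rw [Subgroup.Commensurable.commensurator_mem_iff] at hg
    rw [← commensurable_map_iff (f := (e : G →* H)) (fun a b h => e.injective h),
      map_conjAct_smul] at hg
    exact hg

/-! ### Strictness of the canonical isomorphisms; the `J`-subgroups -/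

/-- The canonical transport isomorphism is strict. [cite: MochizukiAbsTopI2012, Thm 4.7 (ii) p.57] -/
theorem transportTermIso_isStrict (L : E.ChainGroup) : (transportTermIso φ L).IsStrict where
  dom_eq := rfl
  rig_eq := fun x hx => by
    change L.rig x = L.rig (domPullback φ L.dom ⟨φ.hom.arith x, hx⟩)
    congr 1
    apply Subtype.ext
    change (x : E.arith) = φ.inv.arith (φ.hom.arith x)
    rw [iso_inv_hom_arith]

/-- `selfIso` is strict. [cite: MochizukiAbsTopI2012, Thm 4.7 (ii) p.57] -/
theorem selfIso_isStrict (hP₁ : IsSlimGroup E.arith) (hΔ₁ : IsSlimGroup E.geom) (hne₁ : E.geom ≠ ⊥)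
    (hP₂ : IsSlimGroup F.arith) (hΔ₂ : IsSlimGroup F.geom) (hne₂ : F.geom ≠ ⊥) :
    (selfIso φ hP₁ hΔ₁ hne₁ hP₂ hΔ₂ hne₂).IsStrict where
  dom_eq := (Subgroup.map_top_of_surjective _ (isoArith φ).surjective).symm
  rig_eq := fun _ _ => rfl

/-- `isoOfEqSelf` is strict. [cite: MochizukiAbsTopI2012, Thm 4.7 (ii) p.57] -/
theorem isoOfEqSelf_isStrict {hP₁ : IsSlimGroup E.arith} {hΔ₁ : IsSlimGroup E.geom} {hne₁ : E.geom ≠ ⊥}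
    {L : E.ChainGroup} (e : L = ChainGroup.self hP₁ hΔ₁ hne₁) (T : TargetData F) :
    (isoOfEqSelf φ e T).IsStrict := by
  subst e
  exact selfIso_isStrict hP₁ hΔ₁ hne₁ T.hP T.hΔ T.hne

/-- Under a STRICT term isomorphism over `φ`, the `J`-subgroup of `φ(D)` in the target term is the
image of the `J`-subgroup of `D`. [cite: MochizukiAbsTopI2012, Thm 4.7 (ii) p.57] -/
theorem Jgrp_transfer {L : E.ChainGroup} {M : F.ChainGroup} (I : ChainGroupIsoOver φ L M)
    (hI : I.IsStrict) (D : Subgroup E.arith) :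
    Jgrp M (D.map φ.hom.arith.toMonoidHom) = (Jgrp L D).map I.iso.toMonoidHom := by
  have hinj : Function.Injective φ.hom.arith.toMonoidHom := (isoArith φ).injective
  ext z
  simp only [Jgrp, Subgroup.mem_map, Subgroup.mem_subgroupOf]
  constructor
  · rintro ⟨y, hy, rfl⟩
    -- `y ∈ dom_M = φ(dom_L)`: write `y = φ x`
    have hy_dom : (y : F.arith) ∈ L.dom.map φ.hom.arith.toMonoidHom := hI.dom_eq ▸ y.2
    obtain ⟨x, hx_dom, hxy⟩ := hy_dom
    have hyD : (y : F.arith) ∈ D.map φ.hom.arith.toMonoidHom ⊓ F.geom := hy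
    rw [← geom_map_iso φ, ← Subgroup.map_inf_eq _ _ _ hinj] at hyD
    obtain ⟨x', hx', hx'y⟩ := hyD
    have hxx' : x' = x := hinj (hx'y.trans hxy.symm)
    subst hxx'
    have hyeq : y = ⟨φ.hom.arith x', by rw [hI.dom_eq]; exact ⟨x', hx_dom, rfl⟩⟩ :=
      Subtype.ext hxy.symm
    subst hyeq
    exact ⟨L.rig ⟨x', hx_dom⟩, ⟨⟨x', hx_dom⟩, hx', rfl⟩, hI.rig_eq ⟨x', hx_dom⟩ _⟩
  · rintro ⟨_, ⟨x, hx, rfl⟩, rfl⟩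
    have hxM : φ.hom.arith (x : E.arith) ∈ M.dom := by
      rw [hI.dom_eq]; exact ⟨x, x.2, rfl⟩
    refine ⟨⟨φ.hom.arith x, hxM⟩, ?_, ?_⟩
    · change φ.hom.arith (x : E.arith) ∈ D.map φ.hom.arith.toMonoidHom ⊓ F.geom
      rw [← geom_map_iso φ, ← Subgroup.map_inf_eq _ _ _ hinj]
      exact ⟨x, hx, rfl⟩
    · exact (hI.rig_eq x hxM).symm


namespace ChainGroupIsoOver

variable {L : E.ChainGroup} {M : F.ChainGroup} (I : ChainGroupIsoOver φ L M)

/-- Intersecting with `Δⱼ` commutes with the isomorphism: `(I K) ∩ Δ_M = geomJEquiv (K ∩ Δ_L)`.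
[cite: MochizukiAbsTopI2012, Thm 4.7 (ii) p.57] -/
theorem subgroupOf_map (K : Subgroup L.grp) :
    (K.map I.iso.toMonoidHom).subgroupOf M.geomJ =
      (K.subgroupOf L.geomJ).map (I.geomJEquiv : L.geomJ →* M.geomJ) := by
  ext z
  simp only [Subgroup.mem_subgroupOf, Subgroup.mem_map]
  constructor
  · rintro ⟨k, hk, hkz⟩
    have hkJ : k ∈ L.geomJ := by
      have hz : (z : M.grp) ∈ L.geomJ.map I.iso.toMonoidHom := by rw [I.map_geomJ]; exact z.2
      obtain ⟨w, hw, hwz⟩ := hz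
      have : w = k := I.iso.injective (hwz.trans hkz.symm)
      exact this ▸ hw
    refine ⟨⟨k, hkJ⟩, hk, Subtype.ext ?_⟩
    exact hkz
  · rintro ⟨w, hw, rfl⟩
    exact ⟨w, hw, rfl⟩

/-- `I` after the inclusion `Δ_L ⊆ Π_L` is the inclusion `Δ_M ⊆ Π_M` after `geomJEquiv`.
[cite: MochizukiAbsTopI2012, Thm 4.7 (ii) p.57] -/
theorem map_subtype_map (S : Subgroup L.geomJ) :
    (S.map L.geomJ.subtype).map I.iso.toMonoidHom =
      (S.map (I.geomJEquiv : L.geomJ →* M.geomJ)).map M.geomJ.subtype := by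
  ext y
  simp only [Subgroup.mem_map, Subgroup.coe_subtype]
  constructor
  · rintro ⟨_, ⟨w, hw, rfl⟩, rfl⟩
    exact ⟨I.geomJEquiv w, ⟨w, hw, rfl⟩, rfl⟩
  · rintro ⟨_, ⟨w, hw, rfl⟩, rfl⟩
    exact ⟨w, ⟨w, hw, rfl⟩, rfl⟩

end ChainGroupIsoOver

/-! ### Cuspidal decomposition groups and the operation • -/

/-- Symmetry of the cuspidal-data correspondence. [cite: MochizukiAbsTopI2012, Def 4.2 (iii) p.49] -/
theorem CuspidalDataCompat.symm {C₁ : CuspidalData E} {C₂ : CuspidalData F}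
    (h : CuspidalDataCompat φ C₁ C₂) : CuspidalDataCompat φ.symm C₂ C₁ := by
  obtain ⟨σ, hσ⟩ := h
  refine ⟨σ.symm, fun y => ?_⟩
  obtain ⟨g, hg⟩ := hσ (σ.symm y)
  rw [Equiv.apply_symm_apply] at hg
  refine ⟨(φ.inv.arith g)⁻¹, ?_⟩
  have h1 : (C₂.Dcusp y).map φ.symm.hom.arith.toMonoidHom =
      MulAut.conj (φ.inv.arith g) • C₁.Dcusp (σ.symm y) := by
    change (C₂.Dcusp y).map φ.inv.arith.toMonoidHom = _
    rw [hg, map_conj_smul, Subgroup.map_map]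
    have hid : φ.inv.arith.toMonoidHom.comp φ.hom.arith.toMonoidHom = MonoidHom.id _ :=
      MonoidHom.ext (iso_inv_hom_arith φ)
    rw [hid, Subgroup.map_id]
    rfl
  rw [h1, ← mul_smul, ← map_mul, inv_mul_cancel, map_one, one_smul]

/-- A cuspidal decomposition group of `Δⱼ(L)` maps, under a STRICT term isomorphism over `φ` and
corresponding cuspidal data, to a cuspidal decomposition group of `Δⱼ(M)`.
[cite: MochizukiAbsTopI2012, Thm 4.7 (ii) p.57] -/
theorem map_mem_cuspidalDecompGroups {C₁ : CuspidalData E} {C₂ : CuspidalData F}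
    (hC : CuspidalDataCompat φ C₁ C₂) {L : E.ChainGroup} {M : F.ChainGroup}
    (I : ChainGroupIsoOver φ L M) (hI : I.IsStrict) {D : Subgroup L.grp}
    (hD : D ∈ L.cuspidalDecompGroups C₁) : D.map I.iso.toMonoidHom ∈ M.cuspidalDecompGroups C₂ := by
  rw [mem_cuspidalDecompGroups_iff] at hD ⊢
  obtain ⟨x, g, hJ, rfl⟩ := hD
  obtain ⟨σ, hσ⟩ := hC
  obtain ⟨g', hg'⟩ := hσ x
  refine ⟨σ x, φ.hom.arith g * g'⁻¹, ?_, ?_⟩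
  all_goals
    have hS : MulAut.conj (φ.hom.arith g * g'⁻¹) • C₂.Dcusp (σ x) =
        (MulAut.conj g • C₁.Dcusp x).map φ.hom.arith.toMonoidHom := by
      rw [hg', ← mul_smul, ← map_mul, inv_mul_cancel_right, map_conj_smul]
      rfl
  · rw [hS, Jgrp_transfer I hI]
    exact fun h => hJ ((Subgroup.map_eq_bot_iff_of_injective _ I.iso.injective).mp h)
  · rw [hS, Jgrp_transfer I hI, I.subgroupOf_map, commensurator_map_equiv, I.map_subtype_map]

/-! ### The operation • transfers along strict term isomorphisms -/

/-- An elementary operation of type • (de-cuspidalization) transfers along term isomorphisms over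
`φ` whose SOURCE-side isomorphism is strict, for corresponding cuspidal data: conjugate the surjection,
take the image cuspidal decomposition group `I(D)` and the image `I(N)` of the normal open torsion-free
subgroup of `Δⱼ`. [cite: MochizukiAbsTopI2012, Thm 4.7 (ii) p.57] -/
theorem isElemOp_deCusp_transfer {C₁ : CuspidalData E} {C₂ : CuspidalData F}
    (hC : CuspidalDataCompat φ C₁ C₂) {L L' : E.ChainGroup} {M M' : F.ChainGroup}
    (I : ChainGroupIsoOver φ L M) (hI : I.IsStrict) (I' : ChainGroupIsoOver φ L' M')
    (h : ChainGroup.IsElemOp C₁ .deCusp L L') : ChainGroup.IsElemOp C₂ .deCusp M M' := by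
  obtain ⟨ψ, hsurj, hrig, D, hD, hker, N, hN, hNnormal, hNopen, hNtf, hDN⟩ := h
  refine ⟨conjHom I I' ψ, ?_, rigCompat_transfer I I' ψ hrig, D.map I.iso.toMonoidHom,
    map_mem_cuspidalDecompGroups hC I hI hD, kerTopNormallyGeneratedBy_transfer I I' ψ D hker,
    N.map I.iso.toMonoidHom, ?_, ?_, ?_, ?_, Subgroup.map_mono hDN⟩
  · intro z
    obtain ⟨x, hx⟩ := hsurj (I'.iso.symm z)
    exact ⟨I.iso x, by rw [conjHom_apply, I.iso.symm_apply_apply, hx, I'.iso.apply_symm_apply]⟩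
  · rw [← I.map_geomJ]
    exact Subgroup.map_mono hN
  · rw [I.subgroupOf_map]
    exact hNnormal.map _ I.geomJEquiv.surjective
  · rw [I.subgroupOf_map, Subgroup.coe_map]
    change IsOpen (I.geomJEquiv.toEquiv '' _)
    rw [Equiv.image_eq_preimage_symm]
    exact hNopen.preimage I.continuous_geomJEquiv_symm
  · intro n hn
    -- pull `n` back to `N` along the isomorphism `N ≃* I(N)`
    let e : N ≃* (N.map I.iso.toMonoidHom : Subgroup M.grp) := I.iso.toMulEquiv.subgroupMap N
    have h1 : e.symm n = 1 := hNtf _ ((e.symm : _ →* N).isOfFinOrder hn)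
    have h2 : n = e (e.symm n) := (e.apply_symm_apply n).symm
    rw [h2, h1, map_one]


end Literature.AnabelianGeometry.AbsoluteAnabelian.AbsTopI
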